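import Mathlib

/-!
# Stub `stub_residueTransfer` of crux `ChowBorderDepth3.ChowBorderBound`
# (stmt-ValiantsHypothesis-5936), line `registered`

"Border semicontinuity" for the divide–derive calculus.  Work in the ambient ring
`Â := MvPolynomial (Option (Fin n × Fin n)) ℂ` with distinguished variable `ε := X none`, the
`ε`-constants `ι := Polynomial.aeval ε : ℂ[X] →ₐ[ℂ] Â` and the reduction
`red : Â →ₐ[ℂ] MvPolynomial (Fin n × Fin n) ℂ` sending `ε ↦ 0`, `X (some v) ↦ X v`.

## Statement

If more than `card K₁` polynomials `Y i ∈ Â` (`i : K₂`, `card K₁ < card K₂`) satisfy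
`ε ^ e * Y i = ∑ l, ι (c i l) * G l` for `card K₁` fixed polynomials `G l` and `ε`-constant
coefficients `c i l : ℂ[X]`, then the reductions `red (Y i)` are `ℂ`-linearly dependent.

## Proof

(1) The `card K₂ > card K₁` rows `(c i ·) : K₁ → ℂ[X]` are linearly dependent over the
commutative ring `ℂ[X]` (strong rank condition: `LinearIndependent.fintype_card_le_finrank`,
`Module.finrank_fintype_fun_eq_card`), giving `d : K₂ → ℂ[X]`, not all zero, with
`∑ i, d i * c i l = 0` for every `l`.
(2) Divide the `d i` by the largest common power `X ^ e₀` (the minimum of the trailing degrees of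
the nonzero `d i`): `d i = X ^ e₀ * d' i` with some constant term `(d' i₀).coeff 0 ≠ 0`.
(3) In `Â`: `∑ i, ι (d i) * (ε ^ e * Y i) = ∑ l, ι (∑ i, d i * c i l) * G l = 0`, i.e.
`ε ^ (e + e₀) * ∑ i, ι (d' i) * Y i = 0`, hence `∑ i, ι (d' i) * Y i = 0` since `Â` is a domain.
(4) Apply `red`: `red (ι p) = C (p.coeff 0)`, so `∑ i, (d' i).coeff 0 • red (Y i) = 0` is a
nontrivial `ℂ`-linear relation.
-/

-- `Summit.ValiantsHypothesis.ValiantsHypothesis.…` is the tree's mandated single-conjunct layout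
-- (Sub = Summit), so the duplicated namespace component is intended.
set_option linter.dupNamespace false

namespace Summit.ValiantsHypothesis.ValiantsHypothesis.Theorems.ChowBorderBound.ResidueTransfer

open scoped Polynomial

/-- Over a nontrivial commutative ring `R`, more than `card K₁` vectors of `K₁ → R` satisfy a
nontrivial `R`-linear relation (strong rank condition). -/
theorem exists_nontrivial_relation {R : Type*} [CommRing R] [Nontrivial R]
    {K₁ K₂ : Type*} [Fintype K₁] [Fintype K₂] (c : K₂ → K₁ → R)
    (h : Fintype.card K₁ < Fintype.card K₂) :
    ∃ d : K₂ → R, (∀ l, ∑ i, d i * c i l = 0) ∧ ∃ i, d i ≠ 0 := by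
  have hli : ¬ LinearIndependent R c := by
    intro hc
    have := hc.fintype_card_le_finrank
    rw [Module.finrank_fintype_fun_eq_card] at this
    omega
  obtain ⟨d, hd, i, hi⟩ := Fintype.not_linearIndependent_iff.mp hli
  refine ⟨d, fun l => ?_, i, hi⟩
  have := congr_fun hd l
  simpa [Finset.sum_apply, Pi.smul_apply, smul_eq_mul] using this

/-- A finite family of polynomials, not all zero, can be divided by a common power `X ^ e₀` so
that some quotient has a nonzero constant term. -/
theorem exists_strip_X_pow {R : Type*} [CommRing R] {K : Type*} [Fintype K]
    (d : K → R[X]) (h : ∃ i, d i ≠ 0) :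
    ∃ (e₀ : ℕ) (d' : K → R[X]), (∀ i, d i = Polynomial.X ^ e₀ * d' i) ∧
      ∃ i, (d' i).coeff 0 ≠ 0 := by
  classical
  obtain ⟨i₀, hi₀mem, hmin⟩ := Finset.exists_min_image (Finset.univ.filter fun i => d i ≠ 0)
    (fun i => (d i).natTrailingDegree) (by obtain ⟨i, hi⟩ := h; exact ⟨i, by simp [hi]⟩)
  have hi₀ : d i₀ ≠ 0 := by simpa using hi₀mem
  have hdvd : ∀ i, Polynomial.X ^ (d i₀).natTrailingDegree ∣ d i := by
    intro i
    by_cases hi : d i = 0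
    · simp [hi]
    · rw [Polynomial.X_pow_dvd_iff]
      intro k hk
      exact Polynomial.coeff_eq_zero_of_lt_natTrailingDegree
        (lt_of_lt_of_le hk (hmin i (by simp [hi])))
  choose d' hd' using hdvd
  refine ⟨(d i₀).natTrailingDegree, d', hd', i₀, ?_⟩
  have hco : (d i₀).coeff (d i₀).natTrailingDegree = (d' i₀).coeff 0 := by
    have h := Polynomial.coeff_X_pow_mul (d' i₀) (d i₀).natTrailingDegree 0
    rwa [zero_add, ← hd' i₀] at h
  rw [← hco]
  exact mt Polynomial.trailingCoeff_eq_zero.mp hi₀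

/-- **Stub `stub_residueTransfer`** (registered stub of crux stmt-ValiantsHypothesis-5936, line
`registered`), border semicontinuity: if more than `card K₁` polynomials `Y i` satisfy
`ε ^ e * Y i = ∑ l, ι (c l) * G l` with `ε`-constant coefficients for `card K₁` fixed `G l`, then
the reductions `red (Y i)` (`ε ↦ 0`) are `ℂ`-linearly dependent. -/
theorem stub_residueTransfer :
    ∀ (n e : ℕ) (K₁ K₂ : Type) [Fintype K₁] [Fintype K₂] (G : K₁ → MvPolynomial (Option (Fin n × Fin n)) ℂ)
      (Y : K₂ → MvPolynomial (Option (Fin n × Fin n)) ℂ), Fintype.card K₁ < Fintype.card K₂ →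
      (∀ i : K₂, ∃ c : K₁ → Polynomial ℂ,
        (MvPolynomial.X (none : Option (Fin n × Fin n)) : MvPolynomial (Option (Fin n × Fin n)) ℂ) ^ e * Y i = ∑ l, Polynomial.aeval (MvPolynomial.X (none : Option (Fin n × Fin n)) : MvPolynomial (Option (Fin n × Fin n)) ℂ) (c l) * G l) →
      ¬ LinearIndependent ℂ (fun i : K₂ =>
          MvPolynomial.aeval (fun o : Option (Fin n × Fin n) => o.elim (0 : MvPolynomial (Fin n × Fin n) ℂ) MvPolynomial.X) (Y i)) := by
  intro n e K₁ K₂ _ _ G Y hcard hY hli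
  classical
  set ε : MvPolynomial (Option (Fin n × Fin n)) ℂ := MvPolynomial.X none with hε
  set red := MvPolynomial.aeval (R := ℂ)
    (fun o : Option (Fin n × Fin n) => o.elim (0 : MvPolynomial (Fin n × Fin n) ℂ) MvPolynomial.X)
    with hred
  choose c hc using hY
  -- (1) a nontrivial `ℂ[X]`-relation among the coefficient rows
  obtain ⟨d, hd, hd0⟩ := exists_nontrivial_relation c hcard
  -- (2) strip the common power of `X`
  obtain ⟨e₀, d', hd', i₀, hi₀⟩ := exists_strip_X_pow d hd0
  -- (3) the relation in `Â`
  have hrel : ∑ i, Polynomial.aeval ε (d i) * (ε ^ e * Y i) = 0 := by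
    calc ∑ i, Polynomial.aeval ε (d i) * (ε ^ e * Y i)
        = ∑ i, ∑ l, Polynomial.aeval ε (d i) * (Polynomial.aeval ε (c i l) * G l) := by
          refine Finset.sum_congr rfl fun i _ => ?_
          rw [hc i, Finset.mul_sum]
      _ = ∑ l, Polynomial.aeval ε (∑ i, d i * c i l) * G l := by
          rw [Finset.sum_comm]
          refine Finset.sum_congr rfl fun l _ => ?_
          rw [map_sum, Finset.sum_mul]
          refine Finset.sum_congr rfl fun i _ => ?_
          rw [map_mul, mul_assoc]
      _ = 0 := by simp [hd]
  have hε0 : ε ≠ 0 := MvPolynomial.X_ne_zero _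
  have hrel2 : ε ^ (e + e₀) * ∑ i, Polynomial.aeval ε (d' i) * Y i = 0 := by
    rw [← hrel, Finset.mul_sum]
    refine Finset.sum_congr rfl fun i _ => ?_
    rw [hd' i, map_mul, map_pow, Polynomial.aeval_X]
    ring
  have hrel3 : ∑ i, Polynomial.aeval ε (d' i) * Y i = 0 :=
    (mul_eq_zero.mp hrel2).resolve_left (pow_ne_zero _ hε0)
  -- (4) reduce modulo `ε`
  have hredι : ∀ p : ℂ[X], red (Polynomial.aeval ε p) = MvPolynomial.C (p.coeff 0) := by
    intro p
    rw [← Polynomial.aeval_algHom_apply, hred, hε, MvPolynomial.aeval_X]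
    show Polynomial.aeval (0 : MvPolynomial (Fin n × Fin n) ℂ) p = _
    rw [← Polynomial.coeff_zero_eq_aeval_zero']
    rfl
  have hsum : ∑ i, (d' i).coeff 0 • red (Y i) = 0 := by
    have h0 := congrArg red hrel3
    rw [map_sum, map_zero] at h0
    rw [← h0]
    refine Finset.sum_congr rfl fun i _ => ?_
    rw [map_mul, hredι, MvPolynomial.smul_eq_C_mul]
  exact hi₀ (Fintype.linearIndependent_iff.mp hli (fun i => (d' i).coeff 0) hsum i₀)

end Summit.ValiantsHypothesis.ValiantsHypothesis.Theorems.ChowBorderBound.ResidueTransfer
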